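import Summits.QuantumFields.YangMills.Cruxes.IRcof.Lines.pinned_cofinal_bill
import Summits.QuantumFields.YangMills.Cruxes.IR.Lines.conformal_exit
import Summits.QuantumFields.YangMills.Cruxes.IR.Lines.flux_purity_split
import HarnessLib

/-!
# Sketch — lens-1 «FEMTO→BULK TRANSFER» (cell `ym-gapexp`, seat `ymfull-r2c-lens-1-g0`) on crux `IRcof`
# (stmt-QuantumFields-26930, `Summit.QuantumFields.YangMills.Theses.BalabanLadder.IRcof`)

HONEST LABEL: finite-volume ∕ conditional typing exercise; `IRcof` ∕ `IR` ∕ PXcof(1∕24) ∕ N_cof are 0∕1; the Yang–Mills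
mass gap (Clay) is NOT proved; nothing below is a theorem about the Wilson measure beyond the kernel-checked COMPOSITIONS
(`pxcof_of_noHalving`, `pxcof_of_twistStep`), whose hypotheses are OPEN.

Two crux ideas, each a PER-OCTAVE transfer law located at a femto-side certificate, composed BY NAME into the slot's load
`PinnedCofinalBill.PinnedExitsCofinalAt θ` (= PXcof(θ), skeleton of record `Cruxes/IRcof/Lines/pinned_cofinal_bill.lean`
d3255819134117aa, stub `stub_pinnedExitsCofinal : PinnedExitsCofinalAt (1/24)`):

* Card `no-halving-octave` (§1): zero-flux box gap in box units (`ConformalExit.BoxGapAtLeast`, idea-9's typed object = the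
  cell instrument's `E₁ − E₀` on `L³`) cannot HALVE under doubling once beyond the free-field ceiling:
  `PXcof(θ) ⇐ PinnedEdgeCof z× ∧ NoHalvingSC z× η ∧ GapToPuritySC z_s c θ` (PROVED composition).
* Card `selfdual-twist-staircase` (§2): the symmetric-torus ('t Hooft self-dual) temporal twist ratio climbs by a fixed
  step per doubling once past a femto-located threshold: `PXcof(θ) ⇐ PinnedTwistEdgeCof r× ∧ TwistStepSC r× ε₀ η₀ ∧
  SymTwistToPuritySC ε₀ κ θ` (PROVED composition).
-/

noncomputable section

open MeasureTheory Filter Topology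
open Literature.MathematicalPhysics.QuantumFieldTheory Literature.MathematicalPhysics.QuantumLattice
open Summit.QuantumFields.YangMills.Cruxes.OSLegsFromFemtoAndGap.DlrCollarTransfer (LowerBounds)
open Summit.QuantumFields.YangMills.Cruxes.IR.ColdPurityBridge (coldDefect)
open Summit.QuantumFields.YangMills.Cruxes.IRcof.PinnedCofinalBill (PinnedExitsCofinalAt)
open Summit.QuantumFields.YangMills.Cruxes.IR.ConformalExit (BoxGapAtLeast boxGapAtLeast_mono)
open Summit.QuantumFields.YangMills.Theorems.FemtoTransferGap (topValue secondValue topValue_nonneg)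
open Summit.QuantumFields.YangMills.Cruxes.IR.FluxPuritySplit (twistedColdZ)

namespace Summit.QuantumFields.YangMills.Cruxes.IRcof.FemtoToBulk

/-! ## §1 Card `no-halving-octave` -/

/-- **NH(z×, η) — NO HALVING beyond the ceiling (the transfer law; crux, SKEW to PXcof).**  Eventually in `β`: for every box
`L ≥ 8` and every `z ≥ z×`, if the zero-flux box gap at `L` is `≥ z` in box units then at `2L` it is `≥ (1+η)·z`, i.e.
`m(2L) ≥ ((1+η)/2)·m(L)`: the physical zero-flux gap does not halve under doubling of the spatial torus.  Free photons ∕ gluons,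
U(1)₄ Coulomb, any CFT: ratio EXACTLY `½` (`η = 0`, scale invariance) — the law is false there with `η > 0` and its marker
`z ≥ z× > 2π` is never met; deep femto SU(N): ratio `½·(g(2L)/g(L))^{2/3} ↘ ½` (Lüscher), so `η` uniform in `β` needs the
LOCATED marker; bulk: ratio `→ 1`. -/
def NoHalvingSC (zx η : ℝ) : Prop :=
  ∀ (G : Type) [Group G] [TopologicalSpace G] [IsTopologicalGroup G] [CompactSpace G],
    IsCompactSimpleLieGroup G → SimplyConnectedSpace G →
    letI : MeasurableSpace G := borel G
    haveI : BorelSpace G := ⟨rfl⟩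
    ∀ r : LatticeRep G, ∃ β₁ : ℝ, ∀ β : ℝ, β₁ ≤ β →
      ∀ (L L' : ℕ) [NeZero L] [NeZero L'], 8 ≤ L → L' = 2 * L → ∀ z : ℝ, zx ≤ z →
        BoxGapAtLeast r.ρ β L z → BoxGapAtLeast r.ρ β L' ((1 + η) * z)

/-- **PinnedEdgeCof(z×) — the femto-side certificate, PINNED and COFINAL (WEAKER than PXcof mod spectral comparison; R2b′-type).**
For every unit map `a` carrying the floor `LowerBounds G r a`: some `T` such that cofinally in `β` a box `L ≥ 8` with
`a(β)·L ≤ T` has zero-flux box gap `≥ z×` — the van Baal window EDGE reached within `T` floor units (idea-9's `PinnedReachSC`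
guard + the pin that `IRcof_false_without_LowerBounds` demands; consumes the floor, honours p630186 ∕ p624174). -/
def PinnedEdgeCof (zx : ℝ) : Prop :=
  ∀ (G : Type) [Group G] [TopologicalSpace G] [IsTopologicalGroup G] [CompactSpace G],
    IsCompactSimpleLieGroup G → SimplyConnectedSpace G →
    letI : MeasurableSpace G := borel G
    haveI : BorelSpace G := ⟨rfl⟩
    ∀ (r : LatticeRep G) (a : ℝ → ℝ), (∀ β, 0 < a β) → Tendsto a atTop (𝓝 0) → LowerBounds G r a →
      ∃ T : ℝ, ∀ β₁ : ℝ, ∃ β : ℝ, β₁ ≤ β ∧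
        ∃ (L : ℕ) (_ : NeZero L), 8 ≤ L ∧ a β * (L : ℝ) ≤ T ∧ BoxGapAtLeast r.ρ β L zx

/-- **GapToPuritySC(z_s, c, θ) — deep-infrared conversion debt (UNDECIDED residual; = idea-10's `F` ∧ a density-of-states bound ∧
the tree's RP extension, at a box whose zero-flux gap is ALREADY `z_s ≈ 20–30` box units).**  Eventually in `β`: a box `L ≥ 8`
with zero-flux gap `≥ z_s` in box units has a `θ`-pure cold `4:1` torus within the factor `c` in scale. -/
def GapToPuritySC (zs : ℝ) (c : ℕ) (θ : ℝ) : Prop :=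
  ∀ (G : Type) [Group G] [TopologicalSpace G] [IsTopologicalGroup G] [CompactSpace G],
    IsCompactSimpleLieGroup G → SimplyConnectedSpace G →
    letI : MeasurableSpace G := borel G
    haveI : BorelSpace G := ⟨rfl⟩
    ∀ r : LatticeRep G, ∃ β₁ : ℝ, ∀ β : ℝ, β₁ ≤ β →
      ∀ (L : ℕ) [NeZero L], 8 ≤ L → BoxGapAtLeast r.ρ β L zs →
        ∃ L' : ℕ, 8 ≤ L' ∧ L' ≤ c * L ∧ coldDefect r.ρ β L' ≤ θ

/-- Iterating the no-halving step `k` times along the dyadic tower `L, 2L, …, 2ᵏL` (one coupling, one representation). -/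
theorem iterate_gap {G : Type} [Group G] [TopologicalSpace G] [IsTopologicalGroup G] [CompactSpace G]
    [MeasurableSpace G] [BorelSpace G] {N : ℕ} (ρ : G →* Matrix (Fin N) (Fin N) ℂ) (β zx η : ℝ) (hη : 0 ≤ η)
    (step : ∀ (L L' : ℕ) [NeZero L] [NeZero L'], 8 ≤ L → L' = 2 * L → ∀ z : ℝ, zx ≤ z →
        BoxGapAtLeast ρ β L z → BoxGapAtLeast ρ β L' ((1 + η) * z))
    (L : ℕ) [NeZero L] (hL : 8 ≤ L) {z : ℝ} (hz : zx ≤ z) (hz0 : 0 ≤ z) (h0 : BoxGapAtLeast ρ β L z) :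
    ∀ (k : ℕ) (L' : ℕ) [NeZero L'], L' = 2 ^ k * L → BoxGapAtLeast ρ β L' ((1 + η) ^ k * z) := by
  intro k
  induction k with
  | zero =>
      intro L' _ hL'
      have hLL : L' = L := by simpa using hL'
      subst hLL
      simpa using h0
  | succ k ih =>
      intro L'' _ hL''
      haveI : NeZero (2 ^ k * L) := ⟨mul_ne_zero (pow_ne_zero _ two_ne_zero) (NeZero.ne L)⟩
      have ihk : BoxGapAtLeast ρ β (2 ^ k * L) ((1 + η) ^ k * z) := ih (2 ^ k * L) rfl
      have h8 : 8 ≤ 2 ^ k * L :=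
        le_trans hL (by simpa [one_mul] using Nat.mul_le_mul_right L (Nat.one_le_two_pow (n := k)))
      have h1 : (1 : ℝ) ≤ (1 + η) ^ k := one_le_pow₀ (by linarith)
      have hmk : zx ≤ (1 + η) ^ k * z := le_trans hz (le_mul_of_one_le_left hz0 h1)
      have hL2 : L'' = 2 * (2 ^ k * L) := by rw [hL'', pow_succ]; ring
      have hs := step (2 ^ k * L) L'' h8 hL2 ((1 + η) ^ k * z) hmk ihk
      have e : (1 + η) ^ (k + 1) * z = (1 + η) * ((1 + η) ^ k * z) := by ring
      rw [e]
      exact hs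

/-- **Kernel-checked SPLIT (card `no-halving-octave`)**: the pinned femto edge, the no-halving transfer law and the deep-IR conversion
give PXcof(θ) BY NAME, with the pin `T' = c·2ᵏ·T`, `k = ⌈log_{1+η}(z_s/z×)⌉` uniform in `β`. -/
theorem pxcof_of_noHalving {zx η zs θ : ℝ} {c : ℕ} (hzx : 0 < zx) (hη : 0 < η)
    (hE : PinnedEdgeCof zx) (hN : NoHalvingSC zx η) (hP : GapToPuritySC zs c θ) :
    PinnedExitsCofinalAt θ := by
  intro G _ _ _ _ hG hsc
  letI : MeasurableSpace G := borel G
  haveI : BorelSpace G := ⟨rfl⟩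
  intro r a ha ha0 hlb
  obtain ⟨T, hT⟩ := hE G hG hsc r a ha ha0 hlb
  obtain ⟨βN, hβN⟩ := hN G hG hsc r
  obtain ⟨βP, hβP⟩ := hP G hG hsc r
  obtain ⟨k, hk⟩ := pow_unbounded_of_one_lt (zs / zx) (by linarith : (1 : ℝ) < 1 + η)
  refine ⟨(c : ℝ) * 2 ^ k * T, fun β₁ => ?_⟩
  obtain ⟨β, hβ, L, instL, hL8, hpin, hgap⟩ := hT (max β₁ (max βN βP))
  haveI : NeZero L := instL
  have hβ₁ : β₁ ≤ β := le_trans (le_max_left _ _) hβ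
  have hβN' : βN ≤ β := le_trans (le_trans (le_max_left _ _) (le_max_right _ _)) hβ
  have hβP' : βP ≤ β := le_trans (le_trans (le_max_right _ _) (le_max_right _ _)) hβ
  haveI : NeZero (2 ^ k * L) := ⟨mul_ne_zero (pow_ne_zero _ two_ne_zero) (NeZero.ne L)⟩
  have hit : BoxGapAtLeast r.ρ β (2 ^ k * L) ((1 + η) ^ k * zx) :=
    iterate_gap r.ρ β zx η hη.le (hβN β hβN') L hL8 le_rfl hzx.le hgap k (2 ^ k * L) rfl
  have hzs : zs ≤ (1 + η) ^ k * zx :=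
    calc zs = zs / zx * zx := (div_mul_cancel₀ zs hzx.ne').symm
      _ ≤ (1 + η) ^ k * zx := mul_le_mul_of_nonneg_right hk.le hzx.le
  have hgap' : BoxGapAtLeast r.ρ β (2 ^ k * L) zs :=
    boxGapAtLeast_mono r.ρ β (2 ^ k * L) hzs (topValue_nonneg _ _ _) hit
  have h8' : 8 ≤ 2 ^ k * L :=
    le_trans hL8 (by simpa [one_mul] using Nat.mul_le_mul_right L (Nat.one_le_two_pow (n := k)))
  obtain ⟨L', hL'8, hL'le, hpure⟩ := hβP β hβP' (2 ^ k * L) h8' hgap'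
  refine ⟨β, hβ₁, L', hL'8, ?_, hpure⟩
  have haβ : 0 < a β := ha β
  have hcast : (L' : ℝ) ≤ (c : ℝ) * (2 ^ k * (L : ℝ)) := by exact_mod_cast hL'le
  calc a β * (L' : ℝ) ≤ a β * ((c : ℝ) * (2 ^ k * (L : ℝ))) := mul_le_mul_of_nonneg_left hcast haβ.le
    _ = (c : ℝ) * 2 ^ k * (a β * L) := by ring
    _ ≤ (c : ℝ) * 2 ^ k * T := mul_le_mul_of_nonneg_left hpin (by positivity)

/-- The slot's tolerance: `θ = 1/24` with the card's located numbers `z× = 7`, `z_s = 28`, `c = 4` (any `η > 0`). -/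
theorem pxcof24_of_noHalving {η : ℝ} (hη : 0 < η) (hE : PinnedEdgeCof 7) (hN : NoHalvingSC 7 η)
    (hP : GapToPuritySC 28 4 (1 / 24)) : PinnedExitsCofinalAt (1 / 24) :=
  pxcof_of_noHalving (by norm_num) hη hE hN hP

/-! ## §2 Card `selfdual-twist-staircase` -/

/-- `G` has a non-trivial central element ('t Hooft twists exist).  False for the centre-less simply-connected compact simple
groups `G₂, F₄, E₈` — the X11 `CenterSymmetryNecessity` scope of every twist-keyed lever. -/
def HasCentralTwist (G : Type) [Group G] : Prop := ∃ c : G, c ∈ Subgroup.center G ∧ c ≠ 1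

/-- **PXcofCentreless(θ) — the declared X11 residual of card `selfdual-twist-staircase`**: PXcof(θ) restricted to CENTRE-LESS
simply-connected `G` (`G₂, F₄, E₈`).  WEAKER than PXcof(θ) by restriction; the twist staircase offers NO lever here (honest: these
groups must go through card `no-halving-octave` or the rank-purity ∕ N_cof family). -/
def PXcofCentreless (θ : ℝ) : Prop :=
  ∀ (G : Type) [Group G] [TopologicalSpace G] [IsTopologicalGroup G] [CompactSpace G],
    IsCompactSimpleLieGroup G → SimplyConnectedSpace G → ¬ HasCentralTwist G →
    letI : MeasurableSpace G := borel G
    haveI : BorelSpace G := ⟨rfl⟩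
    ∀ (r : LatticeRep G) (a : ℝ → ℝ), (∀ β, 0 < a β) → Tendsto a atTop (𝓝 0) → LowerBounds G r a →
      ∃ T : ℝ, ∀ β₁ : ℝ, ∃ β : ℝ, β₁ ≤ β ∧ ∃ L : ℕ, 8 ≤ L ∧ a β * (L : ℝ) ≤ T ∧ coldDefect r.ρ β L ≤ θ

/-- PXcof restricted to centre-less groups is a logical consequence of PXcof (WEAKER tag, kernel-checked). -/
theorem pxcofCentreless_of_pxcof {θ : ℝ} (h : PinnedExitsCofinalAt θ) : PXcofCentreless θ := by
  intro G _ _ _ _ hG hsc _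
  exact h G hG hsc

/-- **Symmetric-torus temporal twist ratio** `r(β, L, c) = Z^{(c)}(L⁴)/Z(L⁴)`: 't Hooft's partition function of the SYMMETRIC
`4`-torus `L⁴` with the central twist `c` in the temporal plane `(0,1)` (idea-10's `twistedColdZ` at `t = L`, twist datum
`Function.update 1 0 c`), over Wilson's.  By hypercubic symmetry of `L⁴` it is ALSO the magnetic-flux (spatial-plane) ratio:
the self-dual reading.  Femto SU(N): `r ≍ g(L)^p → 0` (Lüscher zero modes vs twist-eaters); bulk: `r → 1` (heavy electric flux);
U(1)₄ Coulomb ∕ CFT: `r` = constant in `L`. -/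
def symTwistRatio {G : Type} [Group G] [TopologicalSpace G] [IsTopologicalGroup G] [CompactSpace G]
    [MeasurableSpace G] [BorelSpace G] {N : ℕ} (ρ : G →* Matrix (Fin N) (Fin N) ℂ) (β : ℝ) (L : ℕ) (c : G) : ℝ :=
  twistedColdZ ρ β (Function.update 1 0 c) L L / twistedColdZ ρ β 1 L L

/-- **TwistStep(r×, ε₀, η₀) — the self-dual twist STAIRCASE (transfer law; crux, SKEW to PXcof).**  Eventually in `β`: for every
`L ≥ 8` and every non-trivial central `c`, once `r(β, L, c) ≥ r×` the doubled symmetric torus has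
`r(β, 2L, c) ≥ min (1 − ε₀) (r(β, L, c) + η₀)` — a fixed additive climb per octave until the ceiling `1 − ε₀`.  AF-signed at the
femto end (`r ≍ g(L)^p` strictly increasing in `L`), area-law at the bulk end; EXACTLY violated (`η₀ = 0`) by free photons ∕ any
scale-invariant theory (a fixed point of the staircase). -/
def TwistStepSC (rx ε₀ η₀ : ℝ) : Prop :=
  ∀ (G : Type) [Group G] [TopologicalSpace G] [IsTopologicalGroup G] [CompactSpace G],
    IsCompactSimpleLieGroup G → SimplyConnectedSpace G → HasCentralTwist G →
    letI : MeasurableSpace G := borel G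
    haveI : BorelSpace G := ⟨rfl⟩
    ∀ r : LatticeRep G, ∃ β₁ : ℝ, ∀ β : ℝ, β₁ ≤ β → ∀ L : ℕ, 8 ≤ L →
      ∀ c : G, c ∈ Subgroup.center G → c ≠ 1 → rx ≤ symTwistRatio r.ρ β L c →
        min (1 - ε₀) (symTwistRatio r.ρ β L c + η₀) ≤ symTwistRatio r.ρ β (2 * L) c

/-- **PinnedTwistEdgeCof(r×) — the femto-side threshold, PINNED and COFINAL (deep-femto ∕ R2b′-certifiable: `r ≍ g^p` is
polynomial in the running coupling, so `r×` is reached INSIDE Lüscher's regime, before the van Baal edge).** -/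
def PinnedTwistEdgeCof (rx : ℝ) : Prop :=
  ∀ (G : Type) [Group G] [TopologicalSpace G] [IsTopologicalGroup G] [CompactSpace G],
    IsCompactSimpleLieGroup G → SimplyConnectedSpace G → HasCentralTwist G →
    letI : MeasurableSpace G := borel G
    haveI : BorelSpace G := ⟨rfl⟩
    ∀ (r : LatticeRep G) (a : ℝ → ℝ), (∀ β, 0 < a β) → Tendsto a atTop (𝓝 0) → LowerBounds G r a →
      ∃ T : ℝ, ∀ β₁ : ℝ, ∃ β : ℝ, β₁ ≤ β ∧ ∃ L : ℕ, 8 ≤ L ∧ a β * (L : ℝ) ≤ T ∧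
        ∀ c : G, c ∈ Subgroup.center G → c ≠ 1 → rx ≤ symTwistRatio r.ρ β L c

/-- **SymTwistToPuritySC(ε₀, κ, θ) — conversion debt (UNDECIDED residual; idea-18's (G) `ConfinementHeredityUp` ∕ idea-10's
`coldDefect_le_of_flux_vac` family, in symmetric-torus currency).**  Eventually in `β`: a symmetric torus `L ≥ 8` all of whose
non-trivial central temporal twists are `ε₀`-free has a `θ`-pure cold `4:1` torus within the factor `κ`. -/
def SymTwistToPuritySC (ε₀ : ℝ) (κ : ℕ) (θ : ℝ) : Prop :=
  ∀ (G : Type) [Group G] [TopologicalSpace G] [IsTopologicalGroup G] [CompactSpace G],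
    IsCompactSimpleLieGroup G → SimplyConnectedSpace G → HasCentralTwist G →
    letI : MeasurableSpace G := borel G
    haveI : BorelSpace G := ⟨rfl⟩
    ∀ r : LatticeRep G, ∃ β₁ : ℝ, ∀ β : ℝ, β₁ ≤ β → ∀ L : ℕ, 8 ≤ L →
      (∀ c : G, c ∈ Subgroup.center G → c ≠ 1 → 1 - ε₀ ≤ symTwistRatio r.ρ β L c) →
        ∃ L' : ℕ, 8 ≤ L' ∧ L' ≤ κ * L ∧ coldDefect r.ρ β L' ≤ θ

/-- Climbing the staircase: after `j` doublings every non-trivial twist ratio is `≥ min (1 − ε₀) (r× + j·η₀)`. -/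
theorem iterate_twist {G : Type} [Group G] [TopologicalSpace G] [IsTopologicalGroup G] [CompactSpace G]
    [MeasurableSpace G] [BorelSpace G] {N : ℕ} (ρ : G →* Matrix (Fin N) (Fin N) ℂ) (β rx ε₀ η₀ : ℝ)
    (hrx : rx ≤ 1 - ε₀) (hη₀ : 0 ≤ η₀)
    (step : ∀ L : ℕ, 8 ≤ L → ∀ c : G, c ∈ Subgroup.center G → c ≠ 1 → rx ≤ symTwistRatio ρ β L c →
        min (1 - ε₀) (symTwistRatio ρ β L c + η₀) ≤ symTwistRatio ρ β (2 * L) c)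
    (L : ℕ) (hL : 8 ≤ L) (h0 : ∀ c : G, c ∈ Subgroup.center G → c ≠ 1 → rx ≤ symTwistRatio ρ β L c) :
    ∀ j : ℕ, ∀ c : G, c ∈ Subgroup.center G → c ≠ 1 →
      min (1 - ε₀) (rx + j * η₀) ≤ symTwistRatio ρ β (2 ^ j * L) c := by
  intro j
  induction j with
  | zero =>
      intro c hc hc1
      simp only [Nat.cast_zero, zero_mul, add_zero, pow_zero, one_mul]
      exact le_trans (min_le_right _ _) (h0 c hc hc1)
  | succ j ih =>
      intro c hc hc1
      have h8 : 8 ≤ 2 ^ j * L :=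
        le_trans hL (by simpa [one_mul] using Nat.mul_le_mul_right L (Nat.one_le_two_pow (n := j)))
      have hj := ih c hc hc1
      have hmark : rx ≤ symTwistRatio ρ β (2 ^ j * L) c := by
        refine le_trans ?_ hj
        refine le_min hrx ?_
        have : (0 : ℝ) ≤ j * η₀ := by positivity
        linarith
      have hs := step (2 ^ j * L) h8 c hc hc1 hmark
      have e : 2 ^ (j + 1) * L = 2 * (2 ^ j * L) := by rw [pow_succ]; ring
      rw [e]
      refine le_trans ?_ hs
      -- min (1-ε₀) (rx + (j+1)η₀) ≤ min (1-ε₀) (r_j + η₀), from min (1-ε₀) (rx + j η₀) ≤ r_j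
      rcases le_total (1 - ε₀) (rx + j * η₀) with hcase | hcase
      · -- ceiling already binding at stage j
        have hrj : 1 - ε₀ ≤ symTwistRatio ρ β (2 ^ j * L) c := by
          simpa [min_eq_left hcase] using hj
        refine le_min (min_le_left _ _) ?_
        exact le_trans (min_le_left _ _) (by linarith)
      · have hrj : rx + j * η₀ ≤ symTwistRatio ρ β (2 ^ j * L) c := by
          simpa [min_eq_right hcase] using hj
        refine le_min (min_le_left _ _) (le_trans (min_le_right _ _) ?_)
        push_cast
        linarith

/-- **Kernel-checked SPLIT (card `selfdual-twist-staircase`)**: pinned femto threshold ∧ staircase ∧ conversion ⇒ PXcof(θ) BY NAME,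
with the pin `T' = κ·2^{k₀}·T`, `k₀ = ⌈(1 − ε₀ − r×)/η₀⌉` uniform in `β`. -/
theorem pxcof_of_twistStep {rx ε₀ η₀ θ : ℝ} {κ : ℕ} (hrx : rx ≤ 1 - ε₀) (hη₀ : 0 < η₀)
    (hE : PinnedTwistEdgeCof rx) (hS : TwistStepSC rx ε₀ η₀) (hP : SymTwistToPuritySC ε₀ κ θ)
    (hZ : PXcofCentreless θ) :
    PinnedExitsCofinalAt θ := by
  intro G _ _ _ _ hG hsc
  letI : MeasurableSpace G := borel G
  haveI : BorelSpace G := ⟨rfl⟩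
  intro r a ha ha0 hlb
  by_cases hc : HasCentralTwist G
  swap
  · exact hZ G hG hsc hc r a ha ha0 hlb
  obtain ⟨T, hT⟩ := hE G hG hsc hc r a ha ha0 hlb
  obtain ⟨βS, hβS⟩ := hS G hG hsc hc r
  obtain ⟨βP, hβP⟩ := hP G hG hsc hc r
  set k₀ : ℕ := Nat.ceil ((1 - ε₀ - rx) / η₀) with hk₀
  refine ⟨(κ : ℝ) * 2 ^ k₀ * T, fun β₁ => ?_⟩
  obtain ⟨β, hβ, L, hL8, hpin, hedge⟩ := hT (max β₁ (max βS βP))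
  have hβ₁ : β₁ ≤ β := le_trans (le_max_left _ _) hβ
  have hβS' : βS ≤ β := le_trans (le_trans (le_max_left _ _) (le_max_right _ _)) hβ
  have hβP' : βP ≤ β := le_trans (le_trans (le_max_right _ _) (le_max_right _ _)) hβ
  have hit := iterate_twist r.ρ β rx ε₀ η₀ hrx hη₀.le (hβS β hβS') L hL8 hedge k₀
  have hceil : (1 - ε₀ - rx) / η₀ ≤ (k₀ : ℝ) := Nat.le_ceil _
  have hclimb : 1 - ε₀ ≤ rx + (k₀ : ℝ) * η₀ := by
    have := (div_le_iff₀ hη₀).1 hceil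
    linarith
  have hfree : ∀ c : G, c ∈ Subgroup.center G → c ≠ 1 → 1 - ε₀ ≤ symTwistRatio r.ρ β (2 ^ k₀ * L) c := by
    intro c hc hc1
    have := hit c hc hc1
    rwa [min_eq_left hclimb] at this
  have h8' : 8 ≤ 2 ^ k₀ * L :=
    le_trans hL8 (by simpa [one_mul] using Nat.mul_le_mul_right L (Nat.one_le_two_pow (n := k₀)))
  obtain ⟨L', hL'8, hL'le, hpure⟩ := hβP β hβP' (2 ^ k₀ * L) h8' hfree
  refine ⟨β, hβ₁, L', hL'8, ?_, hpure⟩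
  have haβ : 0 < a β := ha β
  have hcast : (L' : ℝ) ≤ (κ : ℝ) * (2 ^ k₀ * (L : ℝ)) := by exact_mod_cast hL'le
  calc a β * (L' : ℝ) ≤ a β * ((κ : ℝ) * (2 ^ k₀ * (L : ℝ))) := mul_le_mul_of_nonneg_left hcast haβ.le
    _ = (κ : ℝ) * 2 ^ k₀ * (a β * L) := by ring
    _ ≤ (κ : ℝ) * 2 ^ k₀ * T := mul_le_mul_of_nonneg_left hpin (by positivity)

/-- The slot's tolerance with the card's located numbers `r× = 1/20`, `ε₀ = 1/12`, `κ = 8` (any `η₀ > 0`). -/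
theorem pxcof24_of_twistStep {η₀ : ℝ} (hη₀ : 0 < η₀) (hE : PinnedTwistEdgeCof (1 / 20))
    (hS : TwistStepSC (1 / 20) (1 / 12) η₀) (hP : SymTwistToPuritySC (1 / 12) 8 (1 / 24))
    (hZ : PXcofCentreless (1 / 24)) : PinnedExitsCofinalAt (1 / 24) :=
  pxcof_of_twistStep (by norm_num) hη₀ hE hS hP hZ

/-! ## §3 Non-vacuity toys (cell rule (N)): the hypothesis SHAPES are inhabited ∕ the laws have fixed points

These are arithmetic shadows only (no Wilson measure): they certify that the quantifier shapes of the two transfer laws are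
satisfiable and exhibit the SCALE-INVARIANT fixed point (`η = 0`, resp. `η₀ = 0`) at which each law degenerates — the typed
reason both laws are false for free photons ∕ U(1)₄ ∕ any CFT and must carry a located marker. -/

/-- Toy for NH: a "box gap" sequence `m(L) = μ − κ/L` (Lüscher-type approach from BELOW, `κ ≥ 0`) never halves under doubling:
`z(2L) = 2Lμ − κ ≥ (1+η)·(Lμ − κ) = (1+η)·z(L)` with `η = 1` whenever `z(L) ≥ 0`; the conformal law `m = C/L` (`z` constant) is
the `η = 0` fixed point. -/
theorem toy_noHalving_massive (μ κ : ℝ) (hκ : 0 ≤ κ) (L : ℝ) :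
    (1 + 1) * (L * μ - κ) ≤ (2 * L) * μ - κ := by nlinarith

theorem toy_noHalving_conformal (C L : ℝ) (hL : L ≠ 0) : (2 * L) * (C / (2 * L)) = (1 + 0) * (L * (C / L)) := by
  field_simp
  ring

/-- Toy for the staircase: the additive climb `r ↦ min (1−ε₀) (r + η₀)` reaches the ceiling from any start `r× ≤ 1 − ε₀` in
`⌈(1−ε₀−r×)/η₀⌉` steps (the arithmetic inside `pxcof_of_twistStep`), while `η₀ = 0` (scale invariance) never moves. -/
theorem toy_staircase_fixedPoint (r ε₀ : ℝ) (h : r ≤ 1 - ε₀) : min (1 - ε₀) (r + 0) = r := by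
  rw [add_zero]
  exact min_eq_right h

end Summit.QuantumFields.YangMills.Cruxes.IRcof.FemtoToBulk

end
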